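import Mathlib
import Literature.Analysis.FluidPDE.NSViscosityRescaling
import Literature.Analysis.FluidPDE.KNSSTypeIIHolds
import Literature.Analysis.FluidPDE.MollifiedSliceTools
import Summits.NavierStokesRegularity.NavierStokesRegularity.Theorems.PlaneEnergyCeilingBoundedPlanarEnergyRegularityZoomLimit
import Summits.NavierStokesRegularity.NavierStokesRegularity.Theorems.PlaneEnergyCeilingBoundedPlanarEnergyRegularityZoomOseenLimit
import Summits.NavierStokesRegularity.NavierStokesRegularity.Theorems.VorticityPacePaceZoomLimit
import Summits.NavierStokesRegularity.NavierStokesRegularity.Theses.VorticityPace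
import HarnessLib

/-!
# `VorticityPace.PaceZoom` — the vorticity-certified KNSS zoom
  (item stmt-NavierStokesRegularity-7781)

**Statement.** `ν > 0`, `T > 0`, `(u, p)` a MAXIMAL classical solution on `ℝ³ × [0, T)` (no smooth
extension past `T`), Leray–Hopf on `[0, T]` from a rapidly decaying datum, satisfying the PACE
conclusion: for some `θ₀ > 0` and times `t` arbitrarily close to `T` there is a point `x` with
`θ₀ ‖u(s, y)‖² ≤ ν ‖curl u(t)(x)‖` for all `s ∈ [0, t]`, `y`. Then there is a bounded ancient mild
solution `v` (`ν = 1`, duality form) with measurable slices and a slice `s < 0` which is NOT a.e.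
equal to a constant.

PROOF (KNSS 2009 §6 zoom-in, vorticity-centred).
1. Normalise `ν = 1`: `w(s) = ν⁻¹ u(s/ν)` on `(0, νT)` (`IsClassicalNSSolutionOn.viscosityRescale_set`);
   `w` is NOT bounded on `(0, νT)` (else `u` extends, `hasSmoothExtensionPast_of_bounded_holds`), its
   slices are uniformly in `L²` (energy inequality). PACE reads `θ₀‖w(s,y)‖² ≤ ‖curl w(τ_k)(x_k)‖`
   for `s ≤ τ_k`, `τ_k ↑ νT`; unboundedness forces `G_k = ‖curl w(τ_k)(x_k)‖ → ∞`.
2. Zoom: `m_k² = G_k/θ₀`, `V_k(s,y) = m_k⁻¹ w(τ_k + s/m_k², x_k + y/m_k)` is classical on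
   `(A_k, B_k)`, `A_k = −τ_k m_k² → −∞`, `A_k ≤ −2 < 0 < B_k`, with `‖V_k‖ ≤ 1` on `(A_k, 0]`,
   square-integrable slices (scaling) and `‖curl V_k(0)(0)‖ = θ₀`.
3. The tools lemma `PaceZoom.exists_ancientMild_of_certifiedZoom`
   (`VorticityPacePaceZoomLimit.lean`: KNSS Lemma 6.1 with vorticity, the certified slice moved to a
   fixed `s = −c < 0` by Landau interpolation against the uniform Lipschitz bound up to the final
   time — no forward continuation is needed) gives the bounded ancient mild solution with a
   non-constant slice.

HONEST FRAMING: a compactness lemma about HYPOTHETICAL blow-up solutions (other route, not a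
pub-ns-dss cell file); nothing here bears on the regularity problem itself.

References: Koch–Nadirashvili–Seregin–Šverák 2009, §4 and §6 (arXiv:0709.3599); Seregin–Šverák
2009; Giga–Miura 2011 §2.1. [KochNadirashviliSereginSverak2009] [SereginSverak2009] [GigaMiura2011]
-/

noncomputable section

set_option linter.dupNamespace false

namespace Summit.NavierStokesRegularity.NavierStokesRegularity.Theorems

open MeasureTheory Set Function Filter Topology TopologicalSpace Metric
open scoped NNReal ENNReal ContDiff
open Literature.Analysis Literature.Analysis.FluidPDE

open PaceZoom in
/-- **`VorticityPace.PaceZoom`** (item stmt-NavierStokesRegularity-7781, module docstring): for a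
maximal classical Leray–Hopf solution from a rapidly decaying datum satisfying the PACE conclusion
with some `θ₀ > 0`, the vorticity-certified KNSS zoom produces a bounded ancient mild solution
(`ν = 1`, duality form) with measurable slices and a slice `s < 0` that is not a.e. constant.
[cite: KochNadirashviliSereginSverak2009, §4 Prop. 4.1, §6 Lemma 6.1 and proof of Thm. 6.1 (arXiv:0709.3599 pp. 8, 11–12)] -/
theorem vorticityPace_paceZoom_proof : Theses.VorticityPace.PaceZoom := by
  intro ν T hν hT u p hmax hLH hdec hpace
  obtain ⟨θ₀, hθ₀, hpace⟩ := hpace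
  have hcl : IsClassicalNSSolutionOn (Ico 0 T) ν 0 u p := hmax.1
  have hne : ¬ HasSmoothExtensionPast ν 0 u T := hmax.2
  have hν' : 0 < ν⁻¹ := inv_pos.2 hν
  have hνT : 0 < ν * T := mul_pos hν hT
  have hu₀2 : MemLp (u 0) 2 volume := hLH.memLp 0 ⟨le_rfl, hT.le⟩
  -- adapted from `BoundedPlanarEnergyRegularity.stub_planarEnergyZoom`
  -- (Theorems/PlaneEnergyCeilingBoundedPlanarEnergyRegularityStubPlanarEnergyZoom.lean), Steps 1–2
  -- ### Step 1: normalise the viscosity to `1`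
  set w : ℝ → EuclideanSpace ℝ (Fin 3) → EuclideanSpace ℝ (Fin 3) := timeRescale ν⁻¹ ν⁻¹ u
    with hwdef
  set q : ℝ → EuclideanSpace ℝ (Fin 3) → ℝ := timeRescale ν⁻¹ (ν⁻¹ ^ 2) p with hqdef
  have hmaps : MapsTo (fun s => ν⁻¹ * s) (Ioo 0 (ν * T)) (Ioo 0 T) := fun s hs =>
    (inv_mul_mem_Ioo_iff hν).2 hs
  have hclw : IsClassicalNSSolutionOn (Ioo 0 (ν * T)) 1 0 w q := by
    have h1 := (hcl.mono Ioo_subset_Ico_self (uniqueDiffOn_Ioo 0 T)).viscosityRescale_set hν.ne'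
      hmaps (uniqueDiffOn_Ioo 0 (ν * T))
    simpa only [timeRescale_zero_force] using h1
  have hw_apply : ∀ s x, w s x = ν⁻¹ • u (ν⁻¹ * s) x := fun s x => rfl
  -- ### Step 2: `w` is not bounded up to `νT`; its slices are uniformly in `L²`
  have hunbw : ¬ ∃ M₁ : ℝ, ∀ s ∈ Ioo 0 (ν * T), ∀ x, ‖w s x‖ ≤ M₁ := by
    rintro ⟨M₁, hM₁⟩
    obtain ⟨C₀, hC₀⟩ := hdec 0 0
    apply hne
    refine hasSmoothExtensionPast_of_bounded_holds hν hT hcl hLH ⟨max (ν * M₁) C₀, fun t ht x => ?_⟩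
    rcases ht.1.eq_or_lt with h0 | h0
    · rw [← h0]
      have h1 := hC₀ x
      rw [pow_zero, one_mul, norm_iteratedFDeriv_zero] at h1
      exact h1.trans (le_max_right _ _)
    · have hs : ν * t ∈ Ioo 0 (ν * T) := ⟨mul_pos hν h0, mul_lt_mul_of_pos_left ht.2 hν⟩
      have h1 := hM₁ (ν * t) hs x
      rw [hw_apply, ← mul_assoc, inv_mul_cancel₀ hν.ne', one_mul, norm_smul, Real.norm_eq_abs,
        abs_of_pos hν'] at h1
      have h2 : ‖u t x‖ ≤ ν * M₁ := by
        rw [inv_mul_le_iff₀ hν] at h1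
        exact h1
      exact h2.trans (le_max_left _ _)
  have hmem_u : ∀ s ∈ Ioo 0 (ν * T), ν⁻¹ * s ∈ Icc 0 T := fun s hs =>
    ⟨(hmaps hs).1.le, (hmaps hs).2.le⟩
  have hL2w : ∀ s ∈ Ioo 0 (ν * T), MemLp (w s) 2 volume := fun s hs =>
    (hLH.memLp _ (hmem_u s hs)).const_smul ν⁻¹
  set K₀ : ℝ≥0∞ := ENNReal.ofReal ν⁻¹ * eLpNorm (u 0) 2 volume with hK₀
  have hK₀top : K₀ ≠ ⊤ := ENNReal.mul_ne_top ENNReal.ofReal_ne_top hu₀2.eLpNorm_ne_top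
  have hK₀b : ∀ s ∈ Ioo 0 (ν * T), eLpNorm (w s) 2 volume ≤ K₀ := by
    intro s hs
    have h1 : w s = ν⁻¹ • u (ν⁻¹ * s) := rfl
    rw [h1, eLpNorm_const_smul, Real.enorm_eq_ofReal hν'.le, hK₀]
    gcongr
    exact hLH.eLpNorm_le_eLpNorm_datum hν.le hu₀2 (hmem_u s hs)
  -- ### Step 3: the PACE hypothesis in the normalised variables
  set T₁ : ℝ := ν * T with hT₁
  have hT₁pos : 0 < T₁ := hνT
  have hpaceW : ∀ k : ℕ, ∃ τ ∈ Ico (T₁ - T₁ / ((k : ℝ) + 2)) T₁, ∃ x : EuclideanSpace ℝ (Fin 3),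
      ∀ s ∈ Icc (0 : ℝ) τ, ∀ y, θ₀ * ‖w s y‖ ^ 2 ≤ ‖curl (w τ) x‖ := by
    intro k
    have hk2 : (0 : ℝ) < (k : ℝ) + 2 := by positivity
    set t₁ : ℝ := T - T / ((k : ℝ) + 2) with ht₁
    have ht₁mem : t₁ ∈ Ico 0 T := by
      refine ⟨?_, ?_⟩
      · rw [ht₁, sub_nonneg]
        exact div_le_self hT.le (by linarith)
      · rw [ht₁]
        exact sub_lt_self _ (div_pos hT hk2)
    obtain ⟨t, ht, x, hx⟩ := hpace t₁ ht₁mem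
    have ht0T : t ∈ Ico 0 T := ⟨ht₁mem.1.trans ht.1, ht.2⟩
    refine ⟨ν * t, ⟨?_, mul_lt_mul_of_pos_left ht.2 hν⟩, x, fun s hs y => ?_⟩
    · have h1 : T₁ - T₁ / ((k : ℝ) + 2) = ν * t₁ := by rw [hT₁, ht₁]; ring
      rw [h1]
      exact mul_le_mul_of_nonneg_left ht.1 hν.le
    · have hs' : ν⁻¹ * s ∈ Icc 0 t := by
        refine ⟨mul_nonneg hν'.le hs.1, ?_⟩
        calc ν⁻¹ * s ≤ ν⁻¹ * (ν * t) := mul_le_mul_of_nonneg_left hs.2 hν'.le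
          _ = t := by rw [← mul_assoc, inv_mul_cancel₀ hν.ne', one_mul]
      have h1 := hx (ν⁻¹ * s) hs' y
      have hdiff : DifferentiableAt ℝ (u t) x :=
        ((hcl.contDiff_velocity ht0T).differentiable (by simp)).differentiableAt
      have hcurl : curl (w (ν * t)) x = ν⁻¹ • curl (u t) x := by
        have hslice : w (ν * t) = fun z => ν⁻¹ • u t z := by
          funext z
          rw [hw_apply, ← mul_assoc, inv_mul_cancel₀ hν.ne', one_mul]
        rw [hslice, curl_eq_curlCLM, curl_eq_curlCLM, fderiv_fun_const_smul hdiff, map_smul]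
      rw [hcurl, norm_smul, Real.norm_eq_abs, abs_of_pos hν', hw_apply, norm_smul,
        Real.norm_eq_abs, abs_of_pos hν', mul_pow]
      have h2 : θ₀ * (ν⁻¹ ^ 2 * ‖u (ν⁻¹ * s) y‖ ^ 2) =
          ν⁻¹ * (ν⁻¹ * (θ₀ * ‖u (ν⁻¹ * s) y‖ ^ 2)) := by ring
      rw [h2]
      refine mul_le_mul_of_nonneg_left ?_ hν'.le
      calc ν⁻¹ * (θ₀ * ‖u (ν⁻¹ * s) y‖ ^ 2) ≤ ν⁻¹ * (ν * ‖curl (u t) x‖) :=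
            mul_le_mul_of_nonneg_left h1 hν'.le
        _ = ‖curl (u t) x‖ := by rw [← mul_assoc, inv_mul_cancel₀ hν.ne', one_mul]
  choose τ hτ xk hτpace using hpaceW
  have hτlt : ∀ k, τ k < T₁ := fun k => (hτ k).2
  have hτhalf : ∀ k, T₁ / 2 ≤ τ k := fun k => by
    have h1 := (hτ k).1
    have h2 : T₁ / ((k : ℝ) + 2) ≤ T₁ / 2 :=
      div_le_div_of_nonneg_left hT₁pos.le two_pos (by
        have := k.cast_nonneg (α := ℝ); linarith)
    linarith
  have hτpos : ∀ k, 0 < τ k := fun k => by linarith [hτhalf k]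
  have hτmem : ∀ k, τ k ∈ Ioo 0 T₁ := fun k => ⟨hτpos k, hτlt k⟩
  -- ### Step 4: the certified vorticity `G k = ‖curl w(τ k)(x k)‖` tends to infinity
  obtain ⟨G, hG⟩ : ∃ G : ℕ → ℝ, ∀ k, G k = ‖curl (w (τ k)) (xk k)‖ := ⟨_, fun _ => rfl⟩
  have hG0 : ∀ k, 0 ≤ G k := fun k => by rw [hG]; exact norm_nonneg _
  have hGpace : ∀ k, ∀ s ∈ Icc (0 : ℝ) (τ k), ∀ y, θ₀ * ‖w s y‖ ^ 2 ≤ G k := fun k s hs y => by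
    rw [hG]; exact hτpace k s hs y
  have hGtend : Tendsto G atTop atTop := by
    refine tendsto_atTop_atTop.2 fun R => ?_
    have hunb' : ∀ M : ℝ, ∃ s ∈ Ioo 0 T₁, ∃ y, M < ‖w s y‖ := by
      intro M
      by_contra hcon
      push Not at hcon
      exact hunbw ⟨M, hcon⟩
    obtain ⟨s₀, hs₀, y₀, hy₀⟩ := hunb' (max 1 (R / θ₀))
    have hpos : 0 < T₁ - s₀ := by linarith [hs₀.2]
    obtain ⟨N, hN⟩ := exists_nat_gt (T₁ / (T₁ - s₀))
    refine ⟨N, fun k hk => ?_⟩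
    have hks : s₀ < τ k := by
      have h1 := (hτ k).1
      have hkN : (N : ℝ) ≤ k := by exact_mod_cast hk
      have hk2 : T₁ / (T₁ - s₀) < (k : ℝ) + 2 := by linarith
      have h3 : T₁ / ((k : ℝ) + 2) < T₁ - s₀ := by
        rw [div_lt_iff₀ (by positivity)]
        calc T₁ = T₁ / (T₁ - s₀) * (T₁ - s₀) := by field_simp
          _ < ((k : ℝ) + 2) * (T₁ - s₀) := mul_lt_mul_of_pos_right hk2 hpos
          _ = (T₁ - s₀) * ((k : ℝ) + 2) := mul_comm _ _
      linarith
    have h1m : 1 ≤ ‖w s₀ y₀‖ := (le_max_left _ _).trans hy₀.le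
    have hRm : R / θ₀ ≤ ‖w s₀ y₀‖ := (le_max_right _ _).trans hy₀.le
    have hRm' : R ≤ θ₀ * ‖w s₀ y₀‖ := by
      rw [div_le_iff₀ hθ₀] at hRm
      linarith
    have h3 : θ₀ * ‖w s₀ y₀‖ ≤ θ₀ * ‖w s₀ y₀‖ ^ 2 := by
      refine mul_le_mul_of_nonneg_left ?_ hθ₀.le
      calc ‖w s₀ y₀‖ = ‖w s₀ y₀‖ * 1 := (mul_one _).symm
        _ ≤ ‖w s₀ y₀‖ * ‖w s₀ y₀‖ := mul_le_mul_of_nonneg_left h1m (norm_nonneg _)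
        _ = ‖w s₀ y₀‖ ^ 2 := (sq _).symm
    have h2 : R ≤ θ₀ * ‖w s₀ y₀‖ ^ 2 := hRm'.trans h3
    exact h2.trans (hGpace k s₀ ⟨hs₀.1.le, hks.le⟩ y₀)
  -- an index beyond which `G ≥ θ₀ · max 1 (4/T₁)`
  obtain ⟨k₀, hk₀⟩ := tendsto_atTop_atTop.1 hGtend (θ₀ * max 1 (4 / T₁))
  have hGk : ∀ j : ℕ, θ₀ * max 1 (4 / T₁) ≤ G (j + k₀) := fun j => hk₀ _ (Nat.le_add_left k₀ j)
  have hGθ : ∀ j : ℕ, θ₀ ≤ G (j + k₀) := fun j =>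
    (le_mul_of_one_le_right hθ₀.le (le_max_left _ _)).trans (hGk j)
  have hG4 : ∀ j : ℕ, θ₀ * (4 / T₁) ≤ G (j + k₀) := fun j =>
    (mul_le_mul_of_nonneg_left (le_max_right _ _) hθ₀.le).trans (hGk j)
  -- ### Step 5: the scales and the rescaled solutions
  set m : ℕ → ℝ := fun j => Real.sqrt (G (j + k₀) / θ₀) with hmdef
  have hmsq : ∀ j, m j ^ 2 = G (j + k₀) / θ₀ := fun j =>
    Real.sq_sqrt (div_nonneg (hG0 _) hθ₀.le)
  have hm1 : ∀ j, 1 ≤ m j := fun j => Real.one_le_sqrt.2 ((one_le_div hθ₀).2 (hGθ j))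
  have hmpos : ∀ j, 0 < m j := fun j => one_pos.trans_le (hm1 j)
  have hm4 : ∀ j, 4 / T₁ ≤ m j ^ 2 := fun j => by
    rw [hmsq, le_div_iff₀ hθ₀, mul_comm]
    exact hG4 j
  have hwle : ∀ j, ∀ s ∈ Icc (0 : ℝ) (τ (j + k₀)), ∀ y, ‖w s y‖ ≤ m j := fun j s hs y => by
    have h1 := hGpace (j + k₀) s hs y
    have h2 : ‖w s y‖ ^ 2 ≤ G (j + k₀) / θ₀ := by
      rw [le_div_iff₀ hθ₀, mul_comm]
      exact h1
    calc ‖w s y‖ = |‖w s y‖| := (abs_of_nonneg (norm_nonneg _)).symm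
      _ ≤ Real.sqrt (G (j + k₀) / θ₀) := Real.abs_le_sqrt h2
  set c : ℕ → ℝ := fun j => (m j)⁻¹ with hcdef
  have hcpos : ∀ j, 0 < c j := fun j => inv_pos.2 (hmpos j)
  have hcm : ∀ j, c j * m j = 1 := fun j => inv_mul_cancel₀ (hmpos j).ne'
  set A : ℕ → ℝ := fun j => -(τ (j + k₀) / c j ^ 2) with hAdef
  set B : ℕ → ℝ := fun j => (T₁ - τ (j + k₀)) / c j ^ 2 with hBdef
  -- the rescaled fields, kept opaque (equations `hV`, `hP`)
  obtain ⟨V, hV⟩ : ∃ V : ℕ → ℝ → EuclideanSpace ℝ (Fin 3) → EuclideanSpace ℝ (Fin 3),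
      ∀ j, V j = c j • stPull (c j ^ 2) (c j) (τ (j + k₀)) (xk (j + k₀)) w := ⟨_, fun _ => rfl⟩
  obtain ⟨P, hP⟩ : ∃ P : ℕ → ℝ → EuclideanSpace ℝ (Fin 3) → ℝ,
      ∀ j, P j = c j ^ 2 • stPull (c j ^ 2) (c j) (τ (j + k₀)) (xk (j + k₀)) q := ⟨_, fun _ => rfl⟩
  have hVcl : ∀ j, IsClassicalNSSolutionOn (Ioo (A j) (B j)) 1 0 (V j) (P j) := fun j => by
    rw [hV j, hP j]
    exact (hclw.nsRescale_translate_zero (hcpos j) (τ (j + k₀)) (xk (j + k₀))).mono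
      (fun _ hs => zoom_time_mem (hcpos j).ne' hs) (uniqueDiffOn_Ioo _ _)
  have hBpos : ∀ j, 0 < B j := fun j =>
    div_pos (by linarith [hτlt (j + k₀)]) (pow_pos (hcpos j) 2)
  have hA_eq : ∀ j, A j = -(τ (j + k₀) * m j ^ 2) := fun j => by
    simp only [hAdef, hcdef, inv_pow, div_inv_eq_mul]
  have hA2 : ∀ j, A j ≤ -2 := fun j => by
    rw [hA_eq, neg_le_neg_iff]
    calc (2 : ℝ) = T₁ / 2 * (4 / T₁) := by field_simp; ring
      _ ≤ τ (j + k₀) * m j ^ 2 :=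
          mul_le_mul (hτhalf _) (hm4 j) (by positivity) (hτpos _).le
  have hAtend : Tendsto A atTop atBot := by
    have h1 : ∀ j, A j ≤ -((T₁ / 2 / θ₀) * G (j + k₀)) := fun j => by
      rw [hA_eq, neg_le_neg_iff, hmsq]
      calc T₁ / 2 / θ₀ * G (j + k₀) = (T₁ / 2) * (G (j + k₀) / θ₀) := by ring
        _ ≤ τ (j + k₀) * (G (j + k₀) / θ₀) :=
            mul_le_mul_of_nonneg_right (hτhalf _) (div_nonneg (hG0 _) hθ₀.le)
    refine tendsto_atBot_mono h1 (tendsto_neg_atTop_atBot.comp ?_)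
    exact (hGtend.comp (tendsto_add_atTop_nat k₀)).const_mul_atTop (by positivity)
  have hVapply : ∀ j s y, V j s y = c j • w (τ (j + k₀) + c j ^ 2 * s) (xk (j + k₀) + c j • y) :=
    fun j s y => by rw [hV j, smul_stPull_apply]
  have hVbd1 : ∀ j, ∀ s ∈ Ioc (A j) 0, ∀ y, ‖V j s y‖ ≤ 1 := fun j s hs y => by
    have hτ' := zoom_time_mem_Ioc (t₀ := τ (j + k₀)) (hcpos j).ne' hs
    rw [hVapply, norm_smul, Real.norm_eq_abs, abs_of_pos (hcpos j)]
    calc c j * ‖w (τ (j + k₀) + c j ^ 2 * s) (xk (j + k₀) + c j • y)‖ ≤ c j * m j :=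
          mul_le_mul_of_nonneg_left (hwle j _ ⟨hτ'.1.le, hτ'.2⟩ _) (hcpos j).le
      _ = 1 := hcm j
  -- the certified vorticity at the apex `(0, 0)` of every rescaled solution
  have hVcurl0 : ∀ j, ‖curl (V j 0) 0‖ = θ₀ := fun j => by
    have hd : Differentiable ℝ (w (τ (j + k₀) + c j ^ 2 * 0)) := by
      rw [mul_zero, add_zero]
      exact ((hclw.contDiff_velocity (hτmem (j + k₀))).differentiable (by simp))
    have h1 : curl (V j 0) 0 = (c j * c j) • curl (w (τ (j + k₀))) (xk (j + k₀)) := by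
      have h := curl_zoom_slice (a := c j) (γ := c j) (x₀ := xk (j + k₀)) hd 0
      rw [mul_zero, add_zero, smul_zero, add_zero] at h
      rw [hV j]
      exact h
    rw [h1, norm_smul, Real.norm_eq_abs, abs_of_pos (mul_pos (hcpos j) (hcpos j)), ← hG]
    have h2 : G (j + k₀) = θ₀ * m j ^ 2 := by
      rw [hmsq]; field_simp
    rw [h2, hcdef]
    field_simp [(hmpos j).ne']
  -- square-integrable slices, uniformly on `(A j, 0]`
  have hVmemT : ∀ j, ∀ s ∈ Ioo (A j) (B j), τ (j + k₀) + c j ^ 2 * s ∈ Ioo 0 T₁ := fun j s hs =>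
    zoom_time_mem (hcpos j).ne' hs
  have hVL2 : ∀ j, ∀ s ∈ Ioo (A j) (B j), MemLp (V j s) 2 volume := fun j s hs => by
    rw [show V j s = fun y => c j • w (τ (j + k₀) + c j ^ 2 * s) (xk (j + k₀) + c j • y) from
      funext (hVapply j s)]
    exact BoundedPlanarEnergyRegularity.memLp_two_zoom_slice (hL2w _ (hVmemT j s hs))
      (xk (j + k₀)) (hcpos j).ne'
  have hVK : ∀ j, ∀ s ∈ Ioc (A j) 0, eLpNorm (V j s) 2 volume ≤
      ENNReal.ofReal (c j) * (ENNReal.ofReal ((c j ^ 3)⁻¹) ^ (1 / (2 : ℝ≥0∞)).toReal * K₀) := by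
    intro j s hs
    have hmem : τ (j + k₀) + c j ^ 2 * s ∈ Ioo 0 T₁ := by
      have h1 := zoom_time_mem_Ioc (t₀ := τ (j + k₀)) (hcpos j).ne' hs
      exact ⟨h1.1, h1.2.trans_lt (hτlt (j + k₀))⟩
    rw [show V j s = fun y => c j • w (τ (j + k₀) + c j ^ 2 * s) (xk (j + k₀) + c j • y) from
      funext (hVapply j s), BoundedPlanarEnergyRegularity.eLpNorm_two_zoom_slice _ _ (hcpos j)]
    gcongr
    exact hK₀b _ hmem
  have hKtop : ∀ j, ENNReal.ofReal (c j) *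
      (ENNReal.ofReal ((c j ^ 3)⁻¹) ^ (1 / (2 : ℝ≥0∞)).toReal * K₀) ≠ ⊤ := fun j =>
    ENNReal.mul_ne_top ENNReal.ofReal_ne_top
      (ENNReal.mul_ne_top (ENNReal.rpow_ne_top_of_nonneg (by positivity) ENNReal.ofReal_ne_top)
        hK₀top)
  -- ### Step 6: KNSS Lemma 6.1 with the certified vorticity (tools lemma)
  exact exists_ancientMild_of_certifiedZoom hθ₀ hAtend hA2 hBpos hVcl hVbd1 hVL2
    (fun j => ⟨_, hKtop j, fun s hs => hVK j s hs⟩) hVcurl0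

end Summit.NavierStokesRegularity.NavierStokesRegularity.Theorems

end
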